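import Mathlib
import Summits.SmoothPoincare4.SmoothPoincare4.Theses.CongruenceShadows

/-!
# Sketch — first lemmas for crux ideas on `HeegaardHandlebodyCongruenceClosed`
(crux item stmt-SmoothPoincare4-14596; ideator 2, round 1). Statements only; nothing is proved
except trivial logic.
-/

noncomputable section

namespace Summit.SmoothPoincare4.SmoothPoincare4.Cruxes.HeegaardHandlebodyCongruenceClosed.Sketch

open Literature.Topology.FourManifolds
open Summit.SmoothPoincare4.SmoothPoincare4.Theses.CongruenceShadows

/-- `S m = S_{3+3m}`. -/
abbrev S (m : ℕ) : Type := SurfaceGroup (3 + 3 * m)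

/-- `N m = (N₀,N₁,N₂)`, the stabilised standard `S⁴` kernel triple of genus `3+3m`. -/
abbrev N (m : ℕ) : TrisectionKernels (3 + 3 * m) := s4Kernels.stabilizeIter m

/-- The crux hypothesis for one `ρ`: `ρ` is congruent to a product `x ∘ c`
(`x ∈ Stab N₀ ∩ Stab N₁`, `c ∈ Stab N₂`) modulo every characteristic finite-index `M`. -/
def ProductCongruent (m : ℕ) (ρ : S m ≃* S m) : Prop :=
  ∀ M : Subgroup (S m), M.Characteristic → M.FiniteIndex →
    ∃ x c : S m ≃* S m, (N m 0).map x.toMonoidHom = N m 0 ∧ (N m 1).map x.toMonoidHom = N m 1 ∧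
      (N m 2).map c.toMonoidHom = N m 2 ∧ ∀ s, ρ s * (x (c s))⁻¹ ∈ M

/-- The crux conclusion for one `ρ`: `ρ ∈ (A ∩ B)·C`. -/
def IsProduct (m : ℕ) (ρ : S m ≃* S m) : Prop :=
  ∃ x c : S m ≃* S m, (N m 0).map x.toMonoidHom = N m 0 ∧ (N m 1).map x.toMonoidHom = N m 1 ∧
    (N m 2).map c.toMonoidHom = N m 2 ∧ ∀ s, ρ s = x (c s)

/-- Read-back: the crux is literally `∀ m ρ, ProductCongruent m ρ → IsProduct m ρ`. -/
theorem crux_iff :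
    HeegaardHandlebodyCongruenceClosed ↔ ∀ (m : ℕ) (ρ : S m ≃* S m), ProductCongruent m ρ → IsProduct m ρ :=
  Iff.rfl

/-! ## Card `pair-rigidity-gate-retraction` -/

/-- FIRST LEMMA (pair rigidity; in print modulo vendoring: Wilton–Zalesskii 2019 Thm 1 +
Perelman + Waldhausen 1968 + Jaco/Leininger–Reid + Dehn–Nielsen–Baer): the two-factor product
`Stab(N_i)·Stab(N₂)` (`i = 0, 1`) IS congruence-closed — a pair `(N_i, ρN₂)` congruent at every
characteristic level to the standard `#ᵏ(S¹×S²)` pair is the standard pair. -/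
def PairProductCongruenceClosed : Prop :=
  ∀ (m : ℕ) (i : Fin 3), i ≠ 2 → ∀ ρ : S m ≃* S m,
    (∀ M : Subgroup (S m), M.Characteristic → M.FiniteIndex →
      ∃ a c : S m ≃* S m, (N m i).map a.toMonoidHom = N m i ∧ (N m 2).map c.toMonoidHom = N m 2 ∧
        ∀ s, ρ s * (a (c s))⁻¹ ∈ M) →
    ∃ a : S m ≃* S m, (N m i).map a.toMonoidHom = N m i ∧
      (N m 2).map a.toMonoidHom = (N m 2).map ρ.toMonoidHom

/-- "Limits of standard trisections are simply connected": under the crux hypothesis the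
triple quotient `S / N₀N₁ρ(N₂)` is trivial (not merely profinitely trivial). -/
def LimitsSimplyConnected : Prop :=
  ∀ (m : ℕ) (ρ : S m ≃* S m), ProductCongruent m ρ →
    N m 0 ⊔ N m 1 ⊔ (N m 2).map ρ.toMonoidHom = ⊤

/-- GATE RETRACTION (claimed provable now, pure algebra over the tree): on the gate locus the
crux hypothesis contains every hypothesis of `ShadowApproximation` for `K = (N₀, N₁, ρN₂)`,
whose conclusion `Iso N K` is the crux conclusion. -/
def GateRetraction : Prop :=
  ShadowApproximation → PairProductCongruenceClosed → LimitsSimplyConnected →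
    HeegaardHandlebodyCongruenceClosed

/-! ## Card `luft-quotient-free-factor-rigidity` -/

section Free

variable (k : ℕ)

/-- The Luft quotient `π₁(H₀) = S/N₀ ≅ F_{3k}`, generators indexed by (handle type, block). -/
abbrev F : Type := FreeGroup (Fin 3 × Fin k)

/-- Coordinate projection keeping the generators of handle type `j`. -/
def prj (j : Fin 3) : F k →* FreeGroup (Fin k) :=
  FreeGroup.lift fun x => if x.1 = j then FreeGroup.of x.2 else 1

/-- `Nt k 0 = image of N₁ in S/N₀` (kills handle types 1, 2), `Nt k 1 = image of N₂`. -/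
def Nt (j : Fin 3) : Subgroup (F k) := (prj k j).ker

/-- FREE PAIR SHADOW RIGIDITY `FPSR(k)`: the `Stab(ker prj₀)`-orbit of the second coordinate
kernel `ker prj₁` among its `Aut F_{3k}`-translates is closed in the congruence topology on
normal subgroups of `F_{3k}` (a relative version of Parzanchevski–Puder / Wilton /
Garrido–Jaikin-Zapirain profinite detection of free factors). -/
def FreePairShadowRigidity : Prop :=
  ∀ θ : F k ≃* F k,
    (∀ M : Subgroup (F k), M.Characteristic → M.FiniteIndex →
      ∃ h : F k ≃* F k, (Nt k 0).map h.toMonoidHom = Nt k 0 ∧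
        (Nt k 1 ⊔ M).map h.toMonoidHom = (Nt k 1).map θ.toMonoidHom ⊔ M) →
    ∃ h : F k ≃* F k, (Nt k 0).map h.toMonoidHom = Nt k 0 ∧
      (Nt k 1).map h.toMonoidHom = (Nt k 1).map θ.toMonoidHom

end Free

/-- FIRST LEMMA of the free-factor line: `FPSR` on the Luft quotient plus pair rigidity force
simple connectivity of every congruence limit of products. -/
def FreeLayerReduction : Prop :=
  (∀ k, FreePairShadowRigidity (k + 1)) → PairProductCongruenceClosed → LimitsSimplyConnected

/-! ## Card `trivial-units-upgrade` -/

/-- All characteristic finite shadows of `T_ρ = (N₀, N₁, ρN₂)` are standard (the hypothesis of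
`ShadowApproximation`, automorphism form). Weaker than `ProductCongruent`. -/
def ShadowStandard (m : ℕ) (ρ : S m ≃* S m) : Prop :=
  ∀ M : Subgroup (S m), M.Characteristic → M.FiniteIndex →
    ∃ ψ : S m ≃* S m, (N m 0 ⊔ M).map ψ.toMonoidHom = N m 0 ⊔ M ∧
      (N m 1 ⊔ M).map ψ.toMonoidHom = N m 1 ⊔ M ∧
      (N m 2 ⊔ M).map ψ.toMonoidHom = (N m 2).map ρ.toMonoidHom ⊔ M

/-- Trivial: product-congruent ⟹ shadow-standard. -/
def productCongruent_shadowStandard : Prop :=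
  ∀ (m : ℕ) (ρ : S m ≃* S m), ProductCongruent m ρ → ShadowStandard m ρ

/-- UPGRADE ("non-abelian class number one"; abelian level = the refuter's GSp₆(ℤ) lemma,
free level `k = 1` = a gcd computation): for INTEGRAL points `ρ ∈ Aut S`, shadow-standard at
all levels already forces product-congruence at all levels. -/
def Upgrade : Prop :=
  ∀ (m : ℕ) (ρ : S m ≃* S m), ShadowStandard m ρ → ProductCongruent m ρ

/-- Under UPGRADE the crux is equivalent to closedness of the SHADOW locus … -/
def ShadowClosed : Prop :=
  ∀ (m : ℕ) (ρ : S m ≃* S m), ShadowStandard m ρ → IsProduct m ρ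

theorem shadowClosed_of_upgrade (hU : Upgrade) (hC : HeegaardHandlebodyCongruenceClosed) :
    ShadowClosed := fun m ρ h => hC m ρ (hU m ρ h)

theorem crux_of_shadowClosed (hP : productCongruent_shadowStandard) (hS : ShadowClosed) :
    HeegaardHandlebodyCongruenceClosed := fun m ρ h => hS m ρ (hP m ρ h)

/-- … and hence predicts that finite shadows DETECT simple connectivity of pair-normalised
kernel triples (the Kervaire–Higman homology 4-sphere test: its trisection must have a
non-standard shadow at some characteristic level). -/
def ShadowsDetectSimpleConnectivity : Prop :=
  ∀ (m : ℕ) (ρ : S m ≃* S m), ShadowStandard m ρ →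
    N m 0 ⊔ N m 1 ⊔ (N m 2).map ρ.toMonoidHom = ⊤


/-! ## Checked sanity lemmas -/

/-- The crux conclusion forces simple connectivity (so `LimitsSimplyConnected` is a NECESSARY
condition of the crux, given that the standard triple has trivial triple quotient). -/
theorem limitsSimplyConnected_of_crux
    (hstd : ∀ m : ℕ, N m 0 ⊔ N m 1 ⊔ N m 2 = ⊤)
    (hC : HeegaardHandlebodyCongruenceClosed) : LimitsSimplyConnected := by
  intro m ρ hρ
  obtain ⟨x, c, hx0, hx1, hc2, hxc⟩ := hC m ρ hρ
  have e0 : (N m 0).map x.toMonoidHom = N m 0 := hx0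
  have e1 : (N m 1).map x.toMonoidHom = N m 1 := hx1
  have e2 : (N m 2).map c.toMonoidHom = N m 2 := hc2
  have hcomp : ρ.toMonoidHom = x.toMonoidHom.comp c.toMonoidHom :=
    MonoidHom.ext fun s => by simpa using hxc s
  have h2 : (N m 2).map ρ.toMonoidHom = (N m 2).map x.toMonoidHom := by
    rw [hcomp, ← Subgroup.map_map, e2]
  calc N m 0 ⊔ N m 1 ⊔ (N m 2).map ρ.toMonoidHom
      = (N m 0).map x.toMonoidHom ⊔ (N m 1).map x.toMonoidHom ⊔ (N m 2).map x.toMonoidHom := by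
        rw [h2, e0, e1]
    _ = (N m 0 ⊔ N m 1 ⊔ N m 2).map x.toMonoidHom := by rw [Subgroup.map_sup, Subgroup.map_sup]
    _ = ⊤ := by rw [hstd m]; exact Subgroup.map_top_of_surjective _ x.surjective

/-- Under UPGRADE, the crux predicts that shadows detect simple connectivity. -/
theorem shadowsDetect_of_upgrade
    (hstd : ∀ m : ℕ, N m 0 ⊔ N m 1 ⊔ N m 2 = ⊤)
    (hU : Upgrade) (hC : HeegaardHandlebodyCongruenceClosed) : ShadowsDetectSimpleConnectivity :=
  fun m ρ h => limitsSimplyConnected_of_crux hstd hC m ρ (hU m ρ h)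


/-! ## Card `unit-defect-dichotomy`: level-wise forms and the abelian rung -/

/-- Shadow-standard at ONE level `M`. -/
def ShadowStandardAt (m : ℕ) (ρ : S m ≃* S m) (M : Subgroup (S m)) : Prop :=
  ∃ ψ : S m ≃* S m, (N m 0 ⊔ M).map ψ.toMonoidHom = N m 0 ⊔ M ∧
    (N m 1 ⊔ M).map ψ.toMonoidHom = N m 1 ⊔ M ∧
    (N m 2 ⊔ M).map ψ.toMonoidHom = (N m 2).map ρ.toMonoidHom ⊔ M

/-- Product-congruent at ONE level `M`. -/
def ProductCongruentAt (m : ℕ) (ρ : S m ≃* S m) (M : Subgroup (S m)) : Prop :=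
  ∃ x c : S m ≃* S m, (N m 0).map x.toMonoidHom = N m 0 ∧ (N m 1).map x.toMonoidHom = N m 1 ∧
    (N m 2).map c.toMonoidHom = N m 2 ∧ ∀ s, ρ s * (x (c s))⁻¹ ∈ M

/-- The abelian level `n`: `[S,S]·Sⁿ` (characteristic, finite index for `n ≥ 1`). -/
def abelianLevel (m n : ℕ) : Subgroup (S m) :=
  commutator (S m) ⊔ Subgroup.closure (Set.range fun s : S m => s ^ n)

/-- ABELIAN UPGRADE (first rung; = the refuter's class-number-one lemma in `GSp_{6k}(ℤ)` pulled back
along `H ↠ (P₀ ∩ P₁)(ℤ)^±`, `C ↠ P₂(ℤ)^±`): shadow-standard at every abelian level ⟹ product-congruent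
at every abelian level. -/
def AbelianUpgrade : Prop :=
  ∀ (m : ℕ) (ρ : S m ≃* S m), (∀ n : ℕ, 0 < n → ShadowStandardAt m ρ (abelianLevel m n)) →
    ∀ n : ℕ, 0 < n → ProductCongruentAt m ρ (abelianLevel m n)

/-- UNIT-DEFECT DETECTION (the `U⁻` branch, = what a proof of `LimitsSimplyConnected` must show):
a pair-normalised `ρ` whose triple quotient is non-trivial is NOT product-congruent at some level,
even if all its shadows are standard. Logically the contrapositive of `LimitsSimplyConnected`. -/
def UnitDefectDetects : Prop :=
  ∀ (m : ℕ) (ρ : S m ≃* S m), N m 0 ⊔ N m 1 ⊔ (N m 2).map ρ.toMonoidHom ≠ ⊤ →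
    ∃ M : Subgroup (S m), M.Characteristic ∧ M.FiniteIndex ∧ ¬ ProductCongruentAt m ρ M

theorem limitsSimplyConnected_of_unitDefectDetects (h : UnitDefectDetects) : LimitsSimplyConnected := by
  intro m ρ hρ
  by_contra hne
  obtain ⟨M, hM, hfi, hnot⟩ := h m ρ hne
  exact hnot (hρ M hM hfi)


/-- Under UPGRADE the rank-6 crux is a load-path substitute for `ShadowApproximation`:
`ShadowsStandard → WaldhausenPairs → Upgrade → crux → NormalFormStablyTrivial` (to be proved: pair-normalise
`K` to `α · T_ρ`, conjugate the shadow witnesses by `α`, upgrade, close, read off `Iso N K`). -/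
def GateLogicViaUpgrade : Prop :=
  ShadowsStandard → WaldhausenPairs → Upgrade → HeegaardHandlebodyCongruenceClosed → NormalFormStablyTrivial

end Summit.SmoothPoincare4.SmoothPoincare4.Cruxes.HeegaardHandlebodyCongruenceClosed.Sketch

end
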